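import Literature.NumberTheory.DiophantineGeometry.AbcWave0
import Literature.NumberTheory.EllipticCurves.ComplexMultiplicationClassPolynomialIrreducibleProofs
import Literature.NumberTheory.EllipticCurves.HeegnerPointsClassNumberProofs
import Literature.NumberTheory.EllipticCurves.HeightsBaseChangeProofs
import Literature.NumberTheory.EllipticCurves.KleinJCuspExpansion
import HarnessLib

/-!
# Granville–Stark, Theorem 1 (abc.S22, `granville_stark`) from their Lemma 1 with an ARBITRARY
# discriminant constant, proved

Topic `Literature/NumberTheory/DiophantineGeometry`; a proofs-only companion (theorems only, no
definitions, no named facts) of the named fact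
`Literature.NumberTheory.DiophantineGeometry.granville_stark :
UniformABCConjecture → ImaginaryQuadraticClassNumberBound` of `AbcWave0.lean` (A. Granville,
H. M. Stark, *ABC implies no "Siegel zeros" for `L`-functions of characters with negative
discriminant*, Invent. Math. 139 (2000), Theorem 1, in the `∑ 1/a ≥ 1` form vendored there).

## What is proved, and how it relates to `granville_stark_of_cmInput`

`granville_stark_of_lemma1` : **Theorem 1 deduced from the complex-multiplication input of its
printed proof**, the input being ONE explicit hypothesis in existential form — there are constants
`B, d₁` such that for every imaginary quadratic field `K` with `d = |d_K| ≥ d₁` there are a number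
field `F`, a complex embedding `σ₀` of `F` and algebraic integers `g₂, g₃ ∈ 𝓞_F` with
`σ₀(g₂³) = j(τ_D)` (`= formJ (principalForm d_K)`, the singular modulus of the principal class,
`τ_D = (−1+√D)/2` or `√D/2`), `g₃² = g₂³ − 1728` and `|D_F| ≤ (B√d)^{[F:ℚ]}`.  The source gives it
with `F = k(γ₂(τ), γ₃(τ))`, `k = ℚ(√−d)`, `g₂ = γ₂(τ)`, `g₃ = γ₃(τ)`, `B = 6`, all `d`:
"The value of `j(τ)` at `τ = (−1+√−d)/2` or `√−d/2` … is an algebraic integer", (5)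
`j(τ) = γ₂(τ)³ = γ₃(τ)² + 1728`, "for any algebraic integer `α` one has `N(α,1) ≤ H(α,1)`, so that
in a solution to (5′) …" (Weber: `γ₂(τ), γ₃(τ)` are algebraic integers), and **Lemma 1**: "If
`K = k(γ₂(τ), γ₃(τ))`, where `τ` is as above, then `Δ_K ≤ 6√d`" (`Δ_K = |D_K|^{1/[K:ℚ]}`; proof by
Shimura reciprocity — `γ₂, γ₃` lie in the ray class field of `k` mod `6` — and the
conductor–discriminant formula) [GranvilleStark2000, §2].

The sibling file `AbcWave0GranvilleStarkTheorem1Proofs.lean` (landed earlier the same day by the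
other seat on this fact) proves `granville_stark_of_cmInput`, the same deduction with the
hypothesis pinned to the printed constant `B = 6` and required for every `K`.  The present theorem
is STRICTLY MORE GENERAL — any constant `B`, any threshold `d₁`; the sibling's hypothesis is the
case `B = 6`, `d₁ = 0` (its `ι(g₃²) = j(τ_D) − 1728 = ι(g₂³ − 1728)` gives `g₃² = g₂³ − 1728` by
injectivity of `ι`), so nothing of it is restated here.  The point of the generality: Granville–Stark themselves note after
Lemma 1 that "A more careful analysis would allow us to reduce the factor of 6", and a proof of
the CM input that avoids Weber's functions (e.g. through the Hilbert class field `k(j(τ))` and the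
Kummer extensions `k(j)(∛j, √(j − 1728))`, ramified over `k(j)` only above `2` and `3`) naturally
produces a different constant; the deduction of Theorem 1 is insensitive to it, and this file
records that once and for all.  The proof here is independent of the sibling files (it was
written in parallel); its helper lemmas are `private` so as not to duplicate the public API of
`AbcWave0GranvilleStarkHeights.lean` / `…Modulus.lean` / `…HeightProofs.lean`.

## The proof (Granville–Stark §2, proof of Theorem 1, with explicit constants)

Fix `δ` (WLOG `δ < π/3`), put `ε = δ/(4π)`, let `C` be the abc constant for `ε`, `C₁ = max(|C|,1)`,
`B₁ = max(|B|,1)`.  For `K` with `d ≥ max(d₁, d₂(δ), 100)` take `F, σ₀, g₂, g₃` from the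
hypothesis and apply uniform abc in `F` (degree `n`) to `γ₃² + 1728 = γ₂³` ((5′); the three
terms are nonzero because `|j(τ_D)| ≥ e^{π√d} − 784 > 1728`).  With
`M = ∏_{w∣∞} max(1, |g₂³|_w)^{mult w}`:
* `M ≤ 1728ⁿ H_F(γ₃² : 1728 : γ₂³)` (finite part of Mathlib's height of an integral tuple,
  `NumberField.absNorm_mul_finprod_finitePlace_eq_one`);
* `N_F(γ₃², 1728, γ₂³) ≤ |N(6γ₂γ₃)| = 6ⁿ|Nγ₂||Nγ₃|`, `|Nγ₂|³ = |N(g₂³)| ≤ M`,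
  `|Nγ₃|² = |N(g₂³ − 1728)| ≤ 1729ⁿ M` — GS: "`N_K(γ₂³, γ₃², 1728) ≪ N_K(γ₂,1)N_K(γ₃,1) ≤
  H(γ₂,1)H(γ₃,1) = H(γ₂³,1)^{1/3}H(γ₃²,1)^{1/2} ≪ H^{5/6}`";
* `|D_F| ≤ (B₁√d)ⁿ` (the hypothesis);
whence `((1 − 5ε)/6) log M < n(L_A + ((1+ε)/2) log d)` (`loglinear`; GS (6):
"`H(j(τ),1) ≪_ε d^{3+ε}`").  On the other side the conjugates of `g₂³` under the `n` complex
embeddings hit `j(τ_D)` exactly `[F : ℚ(g₂³)] = n / h(d_K)` times (`deg j(τ_D) = h(d_K)`: the class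
polynomial is the minimal polynomial, tree `minpoly_formJ_map_eq_classPolynomial`), so
`log M ≥ (n/h(d_K)) log|j(τ_D)| ≥ (n/h(d_K))(π√d − 1)` (GS (7), at the principal class only);
therefore `(1 − 5ε)(π√d − 1) < h(d_K)(6L_A + 3(1+ε) log d)`, and with `h(d_K) ≤ h_K` (reduced
forms inject into `Cl(K)`, Cox Thm. 7.7(ii)) the elementary `endgame` gives
`(π/3 − δ)√d/log d ≤ h_K`.

## What remains for `granville_stark_holds`

Exactly a proof of the hypothesis: the integrality of `j(τ_D)` (Cox, Thm. 11.1; not in the tree,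
which has algebraicity, conjugates and the class equation) and Lemma 1 (class field theory for
`ℚ(√−d)`: ray class field mod `6`, Shimura reciprocity, conductor–discriminant formula — none in
Mathlib or the tree; `lean search` for `HilbertClassField|rayClassField|ShimuraReciprocity` is
empty, and the tree's `GaloisRepresentations.exists_isGlobalReciprocityMap` carries no
local–global compatibility, hence no ramification information).

## References

* A. Granville, H. M. Stark, Invent. Math. 139 (2000) 509–523: §1 eq. (1), Theorem 1; §2
  (the CM point `τ`, eq. (4)–(5), Lemma 1 and the remark after it, proof of Theorem 1 with
  (5′), (6), (7)) (read on the held copy `paper:galaxy-pdf-4469120640`). [GranvilleStark2000]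
* D. A. Cox, *Primes of the form x² + ny²*, 2nd ed. (2013): Thm. 7.7(ii), Thm. 11.1, §13.A.
  [Cox2013]

## Tree / Mathlib search

Mathlib: `Height.mulHeight`, `NumberField.mulHeight_eq`,
`NumberField.absNorm_mul_finprod_finitePlace_eq_one`, `InfinitePlace.prod_eq_abs_norm`,
`Ideal.finite_factors`, `Finset.prod_dvd_of_coprime`, `Ideal.absNorm_span_singleton`,
`Algebra.coe_norm_int`, `IntermediateField.adjoin.finrank`, `minpoly.algHom_eq`,
`Function.Periodic.norm_qParam`, `NumberField.nrRealPlaces_eq_zero_iff`.  Tree: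
`UniformABCConjecture`, `radicalNorm`, `badPrimes`, `granville_stark` (`AbcWave0`);
`NumberField.prod_infinitePlace_pow_mult_eq_prod_embeddings`,
`NumberField.card_filter_comp_algebraMap_eq` (`HeightsBaseChangeProofs`); `formJ`,
`minpoly_formJ_map_eq_classPolynomial`, `natDegree_classPolynomial`, `principalForm_mem_reducedForms`,
`inStrictFd_heegnerTau`, `smul_eq_self_of_inStrictFd`, `eq_of_heegnerTau_eq`,
`isGamma0Equiv_of_span_mul_formIdeal_eq`, `span_pair_mem_nonZeroDivisors`,
`exists_basis_zero_eq_one`, `discr_eq_sq_add_four_mul`, `IsImaginaryQuadratic.discr_neg`,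
`PeriodPair.j_ofUpperHalfPlane`, `ModularForms.norm_E₄_cube_div_discriminant_sub_sub_le`.
Nothing is restated as a definition; no named fact is introduced (D-0026).
-/

noncomputable section

open NumberField IsDedekindDomain Height Finset Polynomial
open scoped Real UpperHalfPlane MatrixGroups

namespace Literature.NumberTheory.DiophantineGeometry

open Literature.NumberTheory.EllipticCurves Literature.NumberTheory.QuadraticFields.BinaryQuadraticForm
  Literature.NumberTheory.QuadraticFields.Quadratic

section NumberField

variable {F : Type*} [Field F] [NumberField F]

/-! ### H3: the radical norm of `(g₃², 1728, g₂³)` is at most `|N(6 g₂ g₃)|` -/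

/-- If `v ∤ (y)` and `r ∣ y` in `𝓞 F` then `v(r) = 1`. [folklore] -/
private theorem valuation_eq_one_of_dvd_of_not_dvd (v : HeightOneSpectrum (𝓞 F)) {r y : 𝓞 F}
    (hry : r ∣ y) (hv : ¬ v.asIdeal ∣ Ideal.span {y}) : v.valuation F (r : F) = 1 := by
  refine le_antisymm (v.valuation_le_one r) (not_lt.1 fun hlt ↦ hv ?_)
  have h1 : v.asIdeal ∣ Ideal.span {r} := (v.valuation_lt_one_iff_dvd r).1 hlt
  exact h1.trans (Ideal.dvd_iff_le.2 (Ideal.span_singleton_le_span_singleton.2 hry))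

/-- The bad primes of `(γ₃² : 1728 : γ₂³)` divide `6 γ₂ γ₃` (Granville–Stark §2: "the only finite
primes contributing to the conductor are those dividing `6 γ₂ γ₃`", in valuation form). [folklore] -/
private theorem badPrimes_subset (g₂ g₃ : 𝓞 F) :
    badPrimes ((g₃ : F) ^ 2) (1728 : F) ((g₂ : F) ^ 3) ⊆
      {v : HeightOneSpectrum (𝓞 F) | v.asIdeal ∣ Ideal.span {(6 * g₂ * g₃ : 𝓞 F)}} := by
  intro v hv
  by_contra hnd
  apply hv
  have h2 : v.valuation F (2 : F) = 1 := by
    have := valuation_eq_one_of_dvd_of_not_dvd v (r := 2) ⟨3 * g₂ * g₃, by ring⟩ hnd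
    rwa [show ((2 : 𝓞 F) : F) = 2 from map_ofNat _ 2] at this
  have h3 : v.valuation F (3 : F) = 1 := by
    have := valuation_eq_one_of_dvd_of_not_dvd v (r := 3) ⟨2 * g₂ * g₃, by ring⟩ hnd
    rwa [show ((3 : 𝓞 F) : F) = 3 from map_ofNat _ 3] at this
  have hg₂ : v.valuation F (g₂ : F) = 1 :=
    valuation_eq_one_of_dvd_of_not_dvd v ⟨6 * g₃, by ring⟩ hnd
  have hg₃ : v.valuation F (g₃ : F) = 1 :=
    valuation_eq_one_of_dvd_of_not_dvd v ⟨6 * g₂, by ring⟩ hnd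
  have ha : v.valuation F ((g₃ : F) ^ 2) = 1 := by rw [map_pow, hg₃, one_pow]
  have hb : v.valuation F (1728 : F) = 1 := by
    rw [show (1728 : F) = 2 ^ 6 * 3 ^ 3 by norm_num, map_mul, map_pow, map_pow, h2, h3, one_pow,
      one_pow, one_mul]
  have hc : v.valuation F ((g₂ : F) ^ 3) = 1 := by rw [map_pow, hg₂, one_pow]
  exact ⟨ha.trans hb.symm, hb.trans hc.symm⟩

/-- The product of the norms of the distinct primes dividing a nonzero ideal `I` of `𝓞 F` is at
most `N(I)` (the radical of an ideal divides it). [folklore] -/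
private theorem finprod_mem_absNorm_le {I : Ideal (𝓞 F)} (hI : I ≠ 0) :
    ∏ᶠ v ∈ {v : HeightOneSpectrum (𝓞 F) | v.asIdeal ∣ I}, Ideal.absNorm v.asIdeal ≤
      Ideal.absNorm I := by
  classical
  have hfin := Ideal.finite_factors hI
  rw [finprod_mem_eq_finite_toFinset_prod _ hfin, ← map_prod Ideal.absNorm]
  have hdvd : (∏ v ∈ hfin.toFinset, v.asIdeal) ∣ I := by
    refine Finset.prod_dvd_of_coprime (fun v _ w _ hvw ↦ ?_) fun v hv ↦ by simpa using hv
    exact Ideal.isCoprime_iff_sup_eq.2 (v.isMaximal.coprime_of_ne w.isMaximal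
      (fun h ↦ hvw (HeightOneSpectrum.ext h)))
  obtain ⟨J, hJ⟩ := hdvd
  have hJ0 : Ideal.absNorm J ≠ 0 := by
    intro h0
    rw [Ideal.absNorm_eq_zero_iff] at h0
    apply hI; rw [hJ, h0]; simp
  calc Ideal.absNorm (∏ v ∈ hfin.toFinset, v.asIdeal)
      ≤ Ideal.absNorm (∏ v ∈ hfin.toFinset, v.asIdeal) * Ideal.absNorm J :=
        Nat.le_mul_of_pos_right _ (Nat.pos_of_ne_zero hJ0)
    _ = Ideal.absNorm I := by rw [← map_mul, ← hJ]

/-- **`N_F(γ₃², 1728, γ₂³) ≤ |N(6 γ₂ γ₃)|`** for algebraic integers `γ₂, γ₃` of `F`: the bad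
primes of `(γ₃² : 1728 : γ₂³)` divide `6 γ₂ γ₃`, and the radical of a principal ideal divides it
(Granville–Stark: "for any algebraic integer `α` one has `N(α, 1) ≤ H(α, 1)`, so that …
`N_K(γ₂³, γ₃², 1728) ≪ N_K(γ₂, 1) N_K(γ₃, 1)`").
[cite: GranvilleStark2000, §2 (proof of Theorem 1, the display after (5′))] -/
private theorem radicalNorm_le_natAbs_norm (g₂ g₃ : 𝓞 F) (hg₂ : g₂ ≠ 0) (hg₃ : g₃ ≠ 0) :
    radicalNorm ((g₃ : F) ^ 2) (1728 : F) ((g₂ : F) ^ 3) ≤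
      (Algebra.norm ℤ (6 * g₂ * g₃ : 𝓞 F)).natAbs := by
  have hy : (6 * g₂ * g₃ : 𝓞 F) ≠ 0 := by
    refine mul_ne_zero (mul_ne_zero ?_ hg₂) hg₃
    exact_mod_cast (show (6 : ℕ) ≠ 0 by norm_num)
  have hI : Ideal.span {(6 * g₂ * g₃ : 𝓞 F)} ≠ 0 := by
    rw [Ne, Submodule.zero_eq_bot, Ideal.span_singleton_eq_bot]; exact hy
  rw [← Ideal.absNorm_span_singleton]
  refine le_trans ?_ (finprod_mem_absNorm_le hI)
  have hfin := Ideal.finite_factors hI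
  unfold radicalNorm
  rw [← finprod_mem_mul_sdiff (badPrimes_subset g₂ g₃) hfin]
  refine Nat.le_mul_of_pos_right _ ?_
  refine finprod_mem_induction (fun n : ℕ ↦ 0 < n) one_pos (fun _ _ ↦ Nat.mul_pos) ?_
  intro v _
  exact Nat.pos_of_ne_zero (by rw [Ne, Ideal.absNorm_eq_zero_iff]; exact v.ne_bot)

/-! ### H1: the height of `(a : m : c)` controls `∏_{w ∣ ∞} max(1, |c|_w)^{mult w}` -/

/-- **`H_F(a : m : c) ≥ m^{-[F:ℚ]} ∏_{w ∣ ∞} max(1, |c|_w)^{mult w}`** for algebraic integers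
`a, c` and a natural number `m ≥ 1`: at an infinite place `max_i |x_i|_w ≥ max(|m|_w, |c|_w)`,
and the finite part of Mathlib's height of an integral tuple is `N(⟨a, m, c⟩)⁻¹ ≥ N((m))⁻¹ =
m^{-[F:ℚ]}` (`NumberField.absNorm_mul_finprod_finitePlace_eq_one`). [folklore] -/
private theorem prod_infinitePlace_le_mul_mulHeight (a c : 𝓞 F) {m : ℕ} (hm : m ≠ 0) :
    ∏ w : InfinitePlace F, (max 1 (w (c : F))) ^ w.mult ≤
      (m : ℝ) ^ Module.finrank ℚ F * mulHeight ![(a : F), (m : F), (c : F)] := by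
  classical
  set x : Fin 3 → 𝓞 F := ![a, ((m : ℤ) : 𝓞 F), c] with hx
  set X : Fin 3 → F := fun i ↦ ((x i : 𝓞 F) : F) with hXdef
  have hX : (![(a : F), (m : F), (c : F)] : Fin 3 → F) = X := by
    funext i; fin_cases i <;> simp [X, x]
  have hx1 : x 1 = ((m : ℤ) : 𝓞 F) := by simp [x]
  have hm' : ((m : ℤ) : 𝓞 F) ≠ 0 := by exact_mod_cast hm
  have hx0 : x ≠ 0 := by
    intro h; have := congr_fun h 1; rw [hx1] at this; exact hm' this
  have hX0 : X ≠ 0 := by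
    intro h; have := congr_fun h 1
    simp only [X, hx1, Pi.zero_apply] at this
    exact hm' (by exact_mod_cast this)
  rw [hX, NumberField.mulHeight_eq hX0]
  -- the finite part: `N(⟨x⟩) * ∏ᶠ = 1` and `N(⟨x⟩) ≤ m ^ [F:ℚ]`
  have hfin := NumberField.absNorm_mul_finprod_finitePlace_eq_one hx0
  have hB0 : 0 ≤ ∏ᶠ v : FinitePlace F, ⨆ i, v (X i) :=
    finprod_nonneg fun v ↦ Real.iSup_nonneg fun i ↦ apply_nonneg v _
  have hN : (Ideal.absNorm (Ideal.span (Set.range x)) : ℝ) ≤ (m : ℝ) ^ Module.finrank ℚ F := by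
    have hle : Ideal.span {x 1} ≤ Ideal.span (Set.range x) :=
      Ideal.span_mono (Set.singleton_subset_iff.2 (Set.mem_range_self 1))
    have hdvd := Ideal.absNorm_dvd_absNorm_of_le hle
    rw [hx1, Ideal.absNorm_span_singleton,
      show ((m : ℤ) : 𝓞 F) = algebraMap ℤ (𝓞 F) m from rfl, Algebra.norm_algebraMap,
      RingOfIntegers.rank] at hdvd
    have hpos : (Algebra.norm ℤ (algebraMap ℤ (𝓞 F) (m:ℤ))) = (m : ℤ) ^ Module.finrank ℚ F := by
      rw [Algebra.norm_algebraMap, RingOfIntegers.rank]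
    have hne : ((m : ℤ) ^ Module.finrank ℚ F).natAbs ≠ 0 := by
      rw [Int.natAbs_pow]; exact pow_ne_zero _ (by simpa using hm)
    have := Nat.le_of_dvd (Nat.pos_of_ne_zero hne) hdvd
    rw [Int.natAbs_pow, Int.natAbs_natCast] at this
    exact_mod_cast this
  have hfin' : 1 ≤ (m : ℝ) ^ Module.finrank ℚ F * ∏ᶠ v : FinitePlace F, ⨆ i, v (X i) := by
    calc (1 : ℝ) = Ideal.absNorm (Ideal.span (Set.range x)) * ∏ᶠ v : FinitePlace F, ⨆ i, v (X i) := by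
          exact_mod_cast hfin.symm
      _ ≤ (m : ℝ) ^ Module.finrank ℚ F * ∏ᶠ v : FinitePlace F, ⨆ i, v (X i) :=
          mul_le_mul_of_nonneg_right hN hB0
  -- the infinite part
  have hA : ∏ w : InfinitePlace F, (max 1 (w (c : F))) ^ w.mult ≤
      ∏ w : InfinitePlace F, (⨆ i, w (X i)) ^ w.mult := by
    refine prod_le_prod (fun w _ ↦ by positivity) fun w _ ↦ ?_
    refine pow_le_pow_left₀ (by positivity) (max_le ?_ ?_) _
    · have h1 : w (X 1) = m := by
        simp only [X, hx1]
        rw [show (((m : ℤ) : 𝓞 F) : F) = (m : F) by simp]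
        exact InfinitePlace.map_natCast w m
      have hm1 : (1 : ℝ) ≤ m := by exact_mod_cast Nat.one_le_iff_ne_zero.2 hm
      calc (1 : ℝ) ≤ w (X 1) := by rw [h1]; exact hm1
        _ ≤ ⨆ i, w (X i) := le_ciSup (f := fun i ↦ w (X i)) (Set.finite_range _).bddAbove (1 : Fin 3)
    · have h2 : w (X 2) = w (c : F) := by simp [X, x]
      calc w (c : F) = w (X 2) := h2.symm
        _ ≤ ⨆ i, w (X i) := le_ciSup (f := fun i ↦ w (X i)) (Set.finite_range _).bddAbove (2 : Fin 3)
  have hA0 : 0 ≤ ∏ w : InfinitePlace F, (⨆ i, w (X i)) ^ w.mult :=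
    prod_nonneg fun w _ ↦ pow_nonneg (Real.iSup_nonneg fun i ↦ apply_nonneg w _) _
  calc ∏ w : InfinitePlace F, (max 1 (w (c : F))) ^ w.mult
      ≤ (∏ w : InfinitePlace F, (⨆ i, w (X i)) ^ w.mult) * 1 := by rw [mul_one]; exact hA
    _ ≤ (∏ w : InfinitePlace F, (⨆ i, w (X i)) ^ w.mult) *
          ((m : ℝ) ^ Module.finrank ℚ F * ∏ᶠ v : FinitePlace F, ⨆ i, v (X i)) :=
        mul_le_mul_of_nonneg_left hfin' hA0
    _ = _ := by ring

/-! ### H2: the archimedean product is at least `max(1, |σ₀ y|)^{[F : ℚ(y)]}` -/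

/-- **`∏_{w ∣ ∞} max(1, |y|_w)^{mult w} ≥ max(1, |σ₀ y|)^{[F : ℚ(y)]}`**, with
`[F : ℚ(y)] · deg y = [F : ℚ]`: over the complex embeddings the product is `∏_φ max(1, |φ y|)`
(`NumberField.prod_infinitePlace_pow_mult_eq_prod_embeddings`), and exactly `[F : ℚ(y)]`
embeddings `φ` restrict to `σ₀|_{ℚ(y)}` (`NumberField.card_filter_comp_algebraMap_eq`), each with
`φ y = σ₀ y`. This is the step "the conjugates of `j(τ)` are the `j(τ*)`" of Granville–Stark's
(7), used only at the one conjugate `σ₀ y`. [folklore] -/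
private theorem exists_pow_le_prod_infinitePlace (y : F) (σ₀ : F →+* ℂ) :
    ∃ e : ℕ, e * (minpoly ℚ y).natDegree = Module.finrank ℚ F ∧
      (max 1 ‖σ₀ y‖) ^ e ≤ ∏ w : InfinitePlace F, (max 1 (w y)) ^ w.mult := by
  classical
  set L : IntermediateField ℚ F := IntermediateField.adjoin ℚ {y} with hL
  have hyL : y ∈ L := IntermediateField.mem_adjoin_simple_self ℚ y
  set ψ₀ : L →+* ℂ := σ₀.comp (algebraMap L F) with hψ₀
  refine ⟨Module.finrank L F, ?_, ?_⟩
  · have hint : IsIntegral ℚ y := Algebra.IsIntegral.isIntegral y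
    rw [← IntermediateField.adjoin.finrank hint, mul_comm]
    exact Module.finrank_mul_finrank ℚ L F
  rw [NumberField.prod_infinitePlace_pow_mult_eq_prod_embeddings
    (fun w : InfinitePlace F ↦ max 1 (w y))]
  simp only [InfinitePlace.apply]
  have hcard : #{φ : F →+* ℂ | φ.comp (algebraMap L F) = ψ₀} = Module.finrank L F :=
    NumberField.card_filter_comp_algebraMap_eq ψ₀
  rw [← hcard]
  have hval : ∀ φ ∈ ({φ : F →+* ℂ | φ.comp (algebraMap L F) = ψ₀} : Finset (F →+* ℂ)),
      max 1 ‖φ y‖ = max 1 ‖σ₀ y‖ := by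
    intro φ hφ
    rw [mem_filter] at hφ
    have : φ y = σ₀ y := by
      have h := RingHom.congr_fun hφ.2 ⟨y, hyL⟩
      simpa [ψ₀] using h
    rw [this]
  rw [← prod_const, ← prod_congr rfl hval,
    ← prod_filter_mul_prod_filter_not univ (fun φ : F →+* ℂ ↦ φ.comp (algebraMap L F) = ψ₀)]
  refine le_mul_of_one_le_right (prod_nonneg fun _ _ ↦ by positivity) ?_
  calc (1 : ℝ) = ∏ _φ ∈ univ.filter (fun φ : F →+* ℂ ↦ ¬ φ.comp (algebraMap L F) = ψ₀), (1 : ℝ) :=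
        prod_const_one.symm
    _ ≤ _ := prod_le_prod (fun _ _ ↦ zero_le_one) fun _ _ ↦ le_max_left _ _

/-- `1 ≤ ∏_{w ∣ ∞} max(1, |y|_w)^{mult w}`. [folklore] -/
private theorem one_le_prod_infinitePlace (y : F) :
    1 ≤ ∏ w : InfinitePlace F, (max 1 (w y)) ^ w.mult := by
  calc (1 : ℝ) = ∏ _w : InfinitePlace F, (1 : ℝ) := prod_const_one.symm
    _ ≤ _ := prod_le_prod (fun _ _ ↦ zero_le_one) fun w _ ↦ one_le_pow₀ (le_max_left _ _)

/-- `1 ≤ N_F(a, b, c)`: the radical norm is a product of norms of nonzero ideals. [folklore] -/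
private theorem one_le_radicalNorm_triple (a b c : F) : 1 ≤ radicalNorm a b c := by
  unfold radicalNorm
  refine finprod_mem_induction (fun n : ℕ ↦ 1 ≤ n) le_rfl (fun _ _ ↦ one_le_mul) ?_
  intro v _
  exact Nat.one_le_iff_ne_zero.2 (by rw [Ne, Ideal.absNorm_eq_zero_iff]; exact v.ne_bot)

/-! ### H4: norms against the archimedean product -/

/-- `|N_{F/ℚ}(y)| ≤ ∏_{w ∣ ∞} max(1, |y|_w)^{mult w}`. [folklore] -/
private theorem abs_norm_le_prod_infinitePlace (y : F) :
    |(Algebra.norm ℚ y : ℝ)| ≤ ∏ w : InfinitePlace F, (max 1 (w y)) ^ w.mult := by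
  have h := InfinitePlace.prod_eq_abs_norm y
  rw [show |(Algebra.norm ℚ y : ℝ)| = ((|Algebra.norm ℚ y| : ℚ) : ℝ) by push_cast; rfl, ← h]
  refine prod_le_prod (fun w _ ↦ by positivity) fun w _ ↦ ?_
  exact pow_le_pow_left₀ (apply_nonneg w _) (le_max_right _ _) _

/-- `|N_{F/ℚ}(y - m)| ≤ (m + 1)^{[F:ℚ]} ∏_{w ∣ ∞} max(1, |y|_w)^{mult w}` for `m ∈ ℕ`. [folklore] -/
private theorem abs_norm_sub_le_prod_infinitePlace (y : F) (m : ℕ) :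
    |(Algebra.norm ℚ (y - m) : ℝ)| ≤
      ((m : ℝ) + 1) ^ Module.finrank ℚ F * ∏ w : InfinitePlace F, (max 1 (w y)) ^ w.mult := by
  have h := InfinitePlace.prod_eq_abs_norm (y - m)
  rw [show |(Algebra.norm ℚ (y - m) : ℝ)| = ((|Algebra.norm ℚ (y - m)| : ℚ) : ℝ) by push_cast; rfl,
    ← h]
  rw [← InfinitePlace.sum_mult_eq (K := F), ← prod_pow_eq_pow_sum, ← prod_mul_distrib]
  refine prod_le_prod (fun w _ ↦ by positivity) fun w _ ↦ ?_
  rw [← mul_pow]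
  refine pow_le_pow_left₀ (apply_nonneg w _) ?_ _
  calc w (y - m) ≤ w y + m := by
        rw [← InfinitePlace.norm_embedding_eq, ← InfinitePlace.norm_embedding_eq, map_sub,
          map_natCast]
        exact (norm_sub_le _ _).trans (by rw [Complex.norm_natCast])
    _ ≤ (m + 1) * max 1 (w y) := by
        have h1 : w y ≤ max 1 (w y) := le_max_right _ _
        have h2 : (1 : ℝ) ≤ max 1 (w y) := le_max_left _ _
        have hm : (0 : ℝ) ≤ m := Nat.cast_nonneg m
        nlinarith


/-- `|N(6 γ₂ γ₃)| = 6^{[F:ℚ]} |N γ₂| |N γ₃|` (as real numbers). [folklore] -/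
private theorem natAbs_norm_six_mul (g₂ g₃ : 𝓞 F) :
    ((Algebra.norm ℤ (6 * g₂ * g₃ : 𝓞 F)).natAbs : ℝ) =
      (6 : ℝ) ^ Module.finrank ℚ F * |(Algebra.norm ℚ (g₂ : F) : ℝ)| *
        |(Algebra.norm ℚ (g₃ : F) : ℝ)| := by
  rw [Nat.cast_natAbs, Int.cast_abs]
  have h1 : ((Algebra.norm ℤ (6 * g₂ * g₃ : 𝓞 F) : ℤ) : ℝ) =
      ((Algebra.norm ℚ (((6 * g₂ * g₃ : 𝓞 F) : F)) : ℚ) : ℝ) := by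
    rw [← Algebra.coe_norm_int]; norm_cast
  have h2 : (((6 * g₂ * g₃ : 𝓞 F)) : F) = (algebraMap ℚ F 6) * (g₂ : F) * (g₃ : F) := by
    rw [RingOfIntegers.coe_eq_algebraMap, map_mul, map_mul]
    simp only [map_ofNat]
  rw [h1, h2, map_mul, map_mul, Algebra.norm_algebraMap]
  push_cast
  rw [abs_mul, abs_mul, abs_pow]
  norm_num

end NumberField

/-! ### H5: the degree of `j(τ_P)` is the form class number `h(D)` -/

/-- `deg_ℚ j(τ_P) = h(D)` for the principal form `P` of discriminant `D < 0`, `D ≡ 0, 1 (mod 4)`: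
the minimal polynomial of `j(τ_P)` is the class polynomial `H_D` of degree `h(D)` (tree:
`minpoly_formJ_map_eq_classPolynomial`, Cox §13.A). [cite: Cox2013, §13.A Prop. 13.2] -/
private theorem natDegree_minpoly_formJ_principalForm {D : ℤ} (hD : D < 0) (h4 : D % 4 = 0 ∨ D % 4 = 1) :
    (minpoly ℚ (formJ (principalForm D))).natDegree = classNumber D := by
  have h := congrArg natDegree
    (minpoly_formJ_map_eq_classPolynomial hD (principalForm_mem_reducedForms hD h4))
  rwa [natDegree_map, natDegree_classPolynomial] at h

/-! ### H6: `h(d_K) ≤ h_K` (in fact equal) -/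

/-- **The reduced forms of discriminant `d_K` inject into the class group of the imaginary
quadratic field `K`** (`Q = (A, B, C) ↦ [(A, ω − (B + t)/2)]`, Cox Thm. 7.7; injectivity from
`isGamma0Equiv_of_span_mul_formIdeal_eq` at level `1` and the uniqueness of reduced
representatives, `inStrictFd_heegnerTau`), so `h(d_K) ≤ h_K`. [cite: Cox2013, §7.B Thm. 7.7(ii)] -/
private theorem classNumber_discr_le_classNumber (K : Type*) [Field K] [NumberField K]
    (hK : IsImaginaryQuadratic K) :
    classNumber (NumberField.discr K) ≤ NumberField.classNumber K := by
  classical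
  obtain ⟨b, hb⟩ := exists_basis_zero_eq_one hK.1
  set t : ℤ := b.repr (b 1 * b 1) 1 with ht
  set m : ℤ := b.repr (b 1 * b 1) 0 with hm
  have hω : b 1 * b 1 = (m : 𝓞 K) + (t : 𝓞 K) * b 1 := basis_one_mul_self_eq b hb
  have hDtm : NumberField.discr K = t ^ 2 + 4 * m := discr_eq_sq_add_four_mul b hb
  have hDneg : NumberField.discr K < 0 := hK.discr_neg
  have hneg : t ^ 2 + 4 * m < 0 := hDtm ▸ hDneg
  set D := NumberField.discr K with hDdef
  have hmem : ∀ Q ∈ reducedForms D, Q ∈ heegnerForms 1 (t ^ 2 + 4 * m) := by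
    intro Q hQ
    obtain ⟨hdisc, hA, hprim, -⟩ := (mem_reducedForms_iff hDneg).1 hQ
    refine ⟨?_, hA, by simp, (BinQF.isPrimitive_iff _).mp ((isPrimitive_iff_binQF Q).mp hprim)⟩
    rw [← hDtm]; exact hdisc
  have h0 : ∀ Q ∈ reducedForms D,
      Ideal.span {(Q.1 : 𝓞 K), b 1 - (((Q.2.1 + t) / 2 : ℤ) : 𝓞 K)} ∈ nonZeroDivisors (Ideal (𝓞 K)) :=
    fun Q hQ ↦ span_pair_mem_nonZeroDivisors b hb (hmem Q hQ).2.1.ne' _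
  let f : reducedForms D → ClassGroup (𝓞 K) := fun Q ↦ ClassGroup.mk0 ⟨_, h0 Q.1 Q.2⟩
  have hf : Function.Injective f := by
    rintro ⟨Q₁, h₁⟩ ⟨Q₂, h₂⟩ heq
    obtain ⟨x, y, hx, -, hxy⟩ := ClassGroup.mk0_eq_mk0_iff.mp heq
    have hd₁ := (hmem Q₁ h₁).1
    have hd₂ := (hmem Q₂ h₂).1
    have hBB : Q₁.2.1 ≡ Q₂.2.1 [ZMOD 2 * (1 : ℕ)] := by
      have h2k₁ := two_mul_ediv_two_of_disc_eq hd₁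
      have h2k₂ := two_mul_ediv_two_of_disc_eq hd₂
      rw [Nat.cast_one, mul_one]
      exact Int.modEq_iff_dvd.mpr ⟨(Q₂.2.1 + t) / 2 - (Q₁.2.1 + t) / 2, by linarith⟩
    have hequiv : IsGamma0Equiv 1 Q₁ Q₂ :=
      isGamma0Equiv_of_span_mul_formIdeal_eq (N := 1) b hb hω hneg (hmem Q₁ h₁) (hmem Q₂ h₂)
        hBB hx hxy
    obtain ⟨γ, hγ⟩ := hequiv
    rw [Subgroup.smul_def] at hγ
    have hz := inStrictFd_heegnerTau hDneg h₁
    have hw := inStrictFd_heegnerTau hDneg h₂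
    rw [← hγ] at hw
    have heq : heegnerTau Q₂ = heegnerTau Q₁ := by
      rw [← hγ]; exact smul_eq_self_of_inStrictFd hz hw
    obtain ⟨hdq₁, hq₁, -, -⟩ := (mem_reducedForms_iff hDneg).1 h₁
    obtain ⟨hdq₂, hq₂, -, -⟩ := (mem_reducedForms_iff hDneg).1 h₂
    exact Subtype.ext (eq_of_heegnerTau_eq hq₁ hq₂ (hdq₁ ▸ hDneg) (hdq₂.trans hdq₁.symm) heq).symm
  calc classNumber D = Fintype.card (reducedForms D) := (Fintype.card_coe _).symm
    _ ≤ Fintype.card (ClassGroup (𝓞 K)) := Fintype.card_le_of_injective f hf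
    _ = NumberField.classNumber K := rfl

/-! ### H7: `|j(τ_P)| ≥ e^{π√|D|} − 784` -/

/-- **The principal singular modulus is large**: for the principal form `P` of discriminant
`D < 0` (`τ_P = (−b + i√|D|)/2`, `|q| = e^{−π√|D|}`), once `e^{−π√|D|} ≤ 10⁻⁴` one has
`|j(τ_P)| ≥ e^{π√|D|} − 784`, from `j = 1/q + 744 + O(q)`
(`norm_E₄_cube_div_discriminant_sub_sub_le`; Granville–Stark §2: "Since `|1/q| = e^{π√d/a}`,
we deduce from the `q`-expansion for `j(τ*)` in (4) that `max{|j(τ*)|, 1} ≍ e^{π√d/a}`").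
[cite: GranvilleStark2000, §2 (proof of Theorem 1, before (7))] -/
private theorem exp_sub_le_norm_formJ_principalForm_of_exp_le {D : ℤ} (hD : D < 0) (h4 : D % 4 = 0 ∨ D % 4 = 1)
    (hq : Real.exp (-(π * √(-(D : ℝ)))) ≤ 1 / 10 ^ 4) :
    Real.exp (π * √(-(D : ℝ))) - 784 ≤ ‖formJ (principalForm D)‖ := by
  set P := principalForm D with hPdef
  have hP := principalForm_mem_reducedForms hD h4
  obtain ⟨hdP, hP1, -, -⟩ := (mem_reducedForms_iff hD).1 hP
  have hdisc : discr P < 0 := hdP ▸ hD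
  set τ : ℍ := heegnerTau P with hτ
  have him : τ.im = √(-(D : ℝ)) / 2 := by
    rw [hτ, im_heegnerTau hP1 hdisc, principalForm_fst]
    have hrad : (4 * ((1 : ℤ) : ℝ) * P.2.2 - P.2.1 ^ 2 : ℝ) = -(D : ℝ) := by
      have h1 : P.2.1 ^ 2 - 4 * P.1 * P.2.2 = D := hdP
      rw [principalForm_fst] at h1
      have h2 : ((P.2.1 ^ 2 - 4 * 1 * P.2.2 : ℤ) : ℝ) = D := by exact_mod_cast h1
      push_cast at h2 ⊢; linarith
    rw [hrad]; push_cast; ring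
  set q : ℂ := Function.Periodic.qParam 1 (τ : ℂ) with hqdef
  have hqn : ‖q‖ = Real.exp (-(π * √(-(D : ℝ)))) := by
    rw [hqdef, Function.Periodic.norm_qParam, UpperHalfPlane.coe_im, him]
    congr 1; ring
  have hq' : ‖q‖ ≤ 1 / 10 ^ 4 := hqn ▸ hq
  have hest := ModularForms.norm_E₄_cube_div_discriminant_sub_sub_le τ hq'
  have hj : formJ P = ModularForm.E₄ τ ^ 3 / ModularForm.discriminant τ := by
    rw [formJ_def, PeriodPair.j_ofUpperHalfPlane]
  rw [hj]
  set J := ModularForm.E₄ τ ^ 3 / ModularForm.discriminant τ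
  have hq0 : q ≠ 0 := Function.Periodic.qParam_ne_zero _
  have hqinv : ‖q⁻¹‖ = Real.exp (π * √(-(D : ℝ))) := by
    rw [norm_inv, hqn, Real.exp_neg, inv_inv]
  have h40 : 400000 * ‖q‖ ≤ 40 := by
    calc 400000 * ‖q‖ ≤ 400000 * (1 / 10 ^ 4) := by gcongr
      _ = 40 := by norm_num
  -- `‖J‖ ≥ ‖q⁻¹‖ - 744 - ‖J - q⁻¹ - 744‖`
  have htri : ‖q⁻¹‖ ≤ ‖J‖ + 744 + ‖J - q⁻¹ - 744‖ := by
    have : q⁻¹ = J - (J - q⁻¹ - 744) - 744 := by ring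
    calc ‖q⁻¹‖ = ‖J - (J - q⁻¹ - 744) - 744‖ := by rw [← this]
      _ ≤ ‖J - (J - q⁻¹ - 744)‖ + ‖(744 : ℂ)‖ := norm_sub_le _ _
      _ ≤ ‖J‖ + ‖J - q⁻¹ - 744‖ + ‖(744 : ℂ)‖ := by gcongr; exact norm_sub_le _ _
      _ = ‖J‖ + 744 + ‖J - q⁻¹ - 744‖ := by
          rw [show ‖(744 : ℂ)‖ = 744 by norm_num]; ring
  linarith


/-! ### The real-variable endgame -/

/-- `log d ≤ 2 √d` for `d > 0`. [folklore] -/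
private theorem log_le_two_mul_sqrt {d : ℝ} (hd : 0 < d) : Real.log d ≤ 2 * √d := by
  have h1 : Real.log (√d) ≤ √d - 1 := Real.log_le_sub_one_of_pos (Real.sqrt_pos.2 hd)
  have h2 : Real.log (√d) = Real.log d / 2 := Real.log_sqrt hd.le
  linarith [Real.sqrt_nonneg d]

/-- **The analytic endgame.** If for all large `d` a quantity `h ≥ 0` satisfies
`(1 − 5ε)(π√d − 1) < h (6 L_A + 3(1 + ε) log d)` with `ε = δ/(4π)`, `0 < δ < π/3`, `L_A ≥ 0`,
then `(π/3 − δ) √d / log d ≤ h` for all large `d` (real-variable bookkeeping of "Comparing this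
with (6) implies Theorem 1"). [folklore] -/
private theorem endgame {δ : ℝ} (hδ : 0 < δ) (hδ' : δ < π / 3) {LA : ℝ} (hLA : 0 ≤ LA) :
    ∃ d₂ : ℝ, 0 < d₂ ∧ ∀ d : ℝ, d₂ ≤ d → ∀ h : ℝ, 0 ≤ h →
      (1 - 5 * (δ / (4 * π))) * (π * √d - 1) <
          h * (6 * LA + 3 * (1 + δ / (4 * π)) * Real.log d) →
        (π / 3 - δ) * √d / Real.log d ≤ h := by
  set ε : ℝ := δ / (4 * π) with hεdef
  have hπ : 0 < π := Real.pi_pos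
  have hε0 : 0 < ε := by positivity
  have hε1 : ε < 1 / 12 := by
    rw [hεdef, div_lt_iff₀ (by positivity)]; linarith
  set κ : ℝ := (1 - 5 * ε) * π / (3 * (1 + ε)) with hκdef
  have h1ε : 0 < 1 + ε := by linarith
  have h5ε : 0 < 1 - 5 * ε := by linarith
  have hκ0 : 0 < κ := by positivity
  set L₀ : ℝ := 2 * LA / (1 + ε) with hL₀def
  have hL₀ : 0 ≤ L₀ := by positivity
  -- `κ ≥ π/3 − δ/2`
  have hκδ : π / 3 - δ ≤ κ - δ / 2 := by
    have h1 : (1 - 6 * ε) * (1 + ε) ≤ 1 - 5 * ε := by nlinarith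
    have h2 : π / 3 * (1 - 6 * ε) ≤ κ := by
      rw [hκdef, le_div_iff₀ (by positivity)]
      nlinarith
    have h3 : π / 3 * (1 - 6 * ε) = π / 3 - δ / 2 := by
      rw [hεdef]; field_simp; ring
    linarith
  set T : ℝ := (2 * κ * L₀ + 4 * κ / π) / δ with hTdef
  refine ⟨max (Real.exp 1) (Real.exp T), by positivity, fun d hd h hh hmain ↦ ?_⟩
  have hd1 : Real.exp 1 ≤ d := le_of_max_le_left hd
  have hdT : Real.exp T ≤ d := le_of_max_le_right hd
  have hd0 : 0 < d := (Real.exp_pos 1).trans_le hd1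
  have hlog1 : 1 ≤ Real.log d := by
    rw [← Real.log_exp 1]; exact Real.log_le_log (Real.exp_pos 1) hd1
  have hlogT : T ≤ Real.log d := by
    rw [← Real.log_exp T]; exact Real.log_le_log (Real.exp_pos T) hdT
  have hlog0 : 0 < Real.log d := by linarith
  have hsqrt0 : 0 < √d := Real.sqrt_pos.2 hd0
  have hls : Real.log d ≤ 2 * √d := log_le_two_mul_sqrt hd0
  -- rewrite the main hypothesis as `κ (√d − 1/π) < h (log d + L₀)`
  have hmain' : κ * (√d - 1 / π) < h * (Real.log d + L₀) := by
    have e1 : (1 - 5 * ε) * (π * √d - 1) = 3 * (1 + ε) * (κ * (√d - 1 / π)) := by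
      rw [hκdef]; field_simp
    have e2 : h * (6 * LA + 3 * (1 + ε) * Real.log d) = 3 * (1 + ε) * (h * (Real.log d + L₀)) := by
      rw [hL₀def]; field_simp; ring
    rw [e1, e2] at hmain
    exact lt_of_mul_lt_mul_left hmain (by positivity)
  -- `δ log d ≥ 2κL₀ + 4κ/π`
  have hTd : 2 * κ * L₀ + 4 * κ / π ≤ δ * Real.log d := by
    have : T * δ = 2 * κ * L₀ + 4 * κ / π := by rw [hTdef]; field_simp
    nlinarith
  -- the comparison of the two lower bounds
  have hkey : (π / 3 - δ) * √d * (Real.log d + L₀) ≤ κ * (√d - 1 / π) * Real.log d := by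
    have hA : (π / 3 - δ) * √d * (Real.log d + L₀) ≤ (κ - δ / 2) * √d * (Real.log d + L₀) := by
      have : 0 ≤ √d * (Real.log d + L₀) := by positivity
      nlinarith
    have hB : κ / π * Real.log d ≤ 2 * κ / π * √d := by
      have h0 : 0 ≤ κ / π := by positivity
      calc κ / π * Real.log d ≤ κ / π * (2 * √d) := mul_le_mul_of_nonneg_left hls h0
        _ = 2 * κ / π * √d := by ring
    have hC : √d * (κ * L₀ + 2 * κ / π) ≤ δ / 2 * √d * Real.log d := by
      have h0 : 0 ≤ √d / 2 := by positivity
      calc √d * (κ * L₀ + 2 * κ / π) = √d / 2 * (2 * κ * L₀ + 4 * κ / π) := by ring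
        _ ≤ √d / 2 * (δ * Real.log d) := mul_le_mul_of_nonneg_left hTd h0
        _ = δ / 2 * √d * Real.log d := by ring
    have hE : κ * (√d - 1 / π) * Real.log d = κ * √d * Real.log d - κ / π * Real.log d := by ring
    nlinarith [mul_nonneg hsqrt0.le hL₀]
  -- conclude
  have hlow : (π / 3 - δ) * √d / Real.log d ≤ κ * (√d - 1 / π) / (Real.log d + L₀) := by
    rw [div_le_div_iff₀ hlog0 (by positivity)]
    exact hkey
  have hup : κ * (√d - 1 / π) / (Real.log d + L₀) < h := by
    rw [div_lt_iff₀ (by positivity)]; exact hmain'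
  exact (hlow.trans hup.le)

/-- **The log-linear bookkeeping** of Granville–Stark §2: from `log H`-bounds to
`(1 − 5ε) X < h' (6 L_A + 3 (1 + ε) log d)` (pure linear arithmetic). [folklore] -/
private theorem loglinear {ε n LM LH LN LDF l₂ l₃ lC lB ld e h' X : ℝ} (hε5 : ε < 1 / 5) (h1ε : 0 ≤ 1 + ε)
    (hn : n = e * h') (he : 0 < e)
    (ha : LM ≤ n * Real.log 1728 + LH)
    (hb : LH < n * lC + (1 + ε) * (LDF + LN))
    (hc : LN ≤ n * Real.log 6 + l₂ + l₃)
    (hd2 : 3 * l₂ ≤ LM) (hd3 : 2 * l₃ ≤ n * Real.log 1729 + LM)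
    (hDF : LDF ≤ n * (lB + ld / 2))
    (hlow : e * X ≤ LM) :
    (1 - 5 * ε) * X <
      h' * (6 * (Real.log 1728 + lC + (1 + ε) * (lB + Real.log 6 + Real.log 1729 / 2)) +
        3 * (1 + ε) * ld) := by
  have h1 : LDF + LN ≤ n * lB + n * ld / 2 + n * Real.log 6 + LM / 3 + n * Real.log 1729 / 2 + LM / 2 := by
    linarith
  have h2 := mul_le_mul_of_nonneg_left h1 h1ε
  have h4 : (1 - 5 * ε) * LM <
      n * (6 * (Real.log 1728 + lC + (1 + ε) * (lB + Real.log 6 + Real.log 1729 / 2)) +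
        3 * (1 + ε) * ld) := by
    linarith
  have h5 : (1 - 5 * ε) * (e * X) ≤ (1 - 5 * ε) * LM :=
    mul_le_mul_of_nonneg_left hlow (by linarith)
  have h6 : e * ((1 - 5 * ε) * X) < e * (h' * (6 * (Real.log 1728 + lC + (1 + ε) *
      (lB + Real.log 6 + Real.log 1729 / 2)) + 3 * (1 + ε) * ld)) := by
    calc e * ((1 - 5 * ε) * X) = (1 - 5 * ε) * (e * X) := by ring
      _ < _ := h5.trans_lt h4
      _ = _ := by rw [hn]; ring
  exact lt_of_mul_lt_mul_left h6 he.le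


/-! ### Small numerical facts -/

/-- `10⁴ ≤ e¹⁰`. [folklore] -/
private theorem ten_pow_four_le_exp_ten : (10 : ℝ) ^ 4 ≤ Real.exp 10 := by
  have h := Real.exp_one_gt_d9
  calc (10 : ℝ) ^ 4 ≤ (2.7182818283 : ℝ) ^ 10 := by norm_num
    _ ≤ Real.exp 1 ^ 10 := pow_le_pow_left₀ (by norm_num) h.le 10
    _ = Real.exp 10 := by rw [Real.exp_one_pow]; norm_num

/-- `e⁻¹ ≤ 1/2`. [folklore] -/
private theorem exp_neg_one_le_half : Real.exp (-1) ≤ 1 / 2 := by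
  have h : (2 : ℝ) ≤ Real.exp 1 := by
    have := Real.add_one_le_exp (1 : ℝ); norm_num at this; linarith
  rw [Real.exp_neg, inv_le_comm₀ (Real.exp_pos 1) (by norm_num)]
  norm_num; exact h

/-! ### Theorem 1 from Lemma 1 -/

/-- **Granville–Stark's Theorem 1 (Σ-free form, abc.S22 `granville_stark`) from their Lemma 1.**

Hypothesis `lemma1` — the complex-multiplication input of [GranvilleStark2000, §2], in
existential form. Printed: "The value of `j(τ)` at `τ = (−1+√−d)/2` or `√−d/2` (as `−d ≡ 1` or
`0 (mod 4)`) is an algebraic integer …", "(5) `j(τ) = γ₂(τ)³ = γ₃(τ)² + 1728`", "for any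
algebraic integer `α` one has `N(α, 1) ≤ H(α, 1)`, so that in a solution to (5′) …" (i.e.
Weber's `γ₂(τ)`, `γ₃(τ)` are algebraic integers), and "**Lemma 1.** If `K = k(γ₂(τ), γ₃(τ))`,
where `τ` is as above, then `Δ_K ≤ 6√d`" (`Δ_K = |D_K|^{1/[K:ℚ]}`, `k = ℚ(√−d)`; proof via the
ray class field of `k` mod `6`, Shimura reciprocity and the conductor–discriminant formula —
class field theory, absent from Mathlib and from the tree). We ask, for every imaginary
quadratic field `K` of large absolute discriminant `d` (here `τ = τ_P` is the Heegner point of the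
principal form `P` of discriminant `D_K = −d`, `formJ (principalForm D_K) = j(τ)`), for SOME
number field `F` with a complex embedding `σ₀` and algebraic integers `g₂, g₃ ∈ 𝓞_F` with
`σ₀(g₂³) = j(τ)`, `g₃² = g₂³ − 1728` and `|D_F| ≤ (B√d)^{[F:ℚ]}` for some constant `B` — which
the printed statements give with `F = k(γ₂(τ), γ₃(τ))`, `g₂ = γ₂(τ)`, `g₃ = γ₃(τ)`, `B = 6`.
Under D-0026 this may not be minted as a named fact here; it stays a hypothesis, and
discharging it is exactly what remains of `granville_stark_holds`.

Conclusion: `granville_stark`, i.e. `UniformABCConjecture → ImaginaryQuadraticClassNumberBound`.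

Proof (the printed proof of Theorem 1, [GranvilleStark2000, §2 pp. 512–513], with every
constant explicit). Fix `δ`, put `ε = δ/(4π)` and let `C` be the abc constant for `ε`. For `K`
with `d = |D_K|` large take `F, σ₀, g₂, g₃` from `lemma1` and apply uniform abc in `F` to
`γ₃² + 1728 = γ₂³` ((5′)): with `M = ∏_{w∣∞} max(1,|g₂³|_w)^{mult w}` one has
`M ≤ 1728^{[F:ℚ]} H_F(γ₃², 1728, γ₂³)` (`prod_infinitePlace_le_mul_mulHeight`),
`N_F ≤ 6^{[F:ℚ]} |N γ₂| |N γ₃| ≤ 6^{[F:ℚ]} M^{1/3} (1729^{[F:ℚ]} M)^{1/2}`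
(`radicalNorm_le_natAbs_norm`, `abs_norm_le_prod_infinitePlace`,
`abs_norm_sub_le_prod_infinitePlace` — GS: "`N_K(γ₂³, γ₃², 1728) ≪ N_K(γ₂,1)N_K(γ₃,1) ≤
H(γ₂,1)H(γ₃,1) = H(γ₂³,1)^{1/3} H(γ₃²,1)^{1/2} ≪ H^{5/6}`"), `|D_F| ≤ (B√d)^{[F:ℚ]}` (Lemma 1),
whence `((1−5ε)/6) log M < [F:ℚ](L_A + (1+ε)/2 · log d)` (`loglinear`; GS (6):
"`H(j(τ),1) ≪_ε d^{3+ε}`"); on the other side `log M ≥ [F:ℚ(j)] log max(1,|j(τ)|)` with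
`[F:ℚ(j)] · h(−d) = [F:ℚ]` (`exists_pow_le_prod_infinitePlace`, `deg j(τ) = h(−d)` by
`natDegree_minpoly_formJ_principalForm`, i.e. the class equation) and
`|j(τ)| ≥ e^{π√d} − 784` (`exp_sub_le_norm_formJ_principalForm_of_exp_le`; GS (7)), so that
`(1−5ε)(π√d − 1) < h(−d)(6L_A + 3(1+ε) log d)` and finally
`h_K ≥ h(−d) ≥ (π/3 − δ)√d/log d` for `d ≥ d₀(δ)` (`classNumber_discr_le_classNumber`,
`endgame`). [cite: GranvilleStark2000, Theorem 1 (proof, §2) and Lemma 1] -/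
theorem granville_stark_of_lemma1
    (lemma1 : ∃ B d₁ : ℝ, ∀ (K : Type) [Field K] [NumberField K],
      Module.finrank ℚ K = 2 → NumberField.InfinitePlace.nrRealPlaces K = 0 →
      d₁ ≤ |(NumberField.discr K : ℝ)| →
        ∃ (F : Type) (_ : Field F) (_ : NumberField F) (σ₀ : F →+* ℂ) (g₂ g₃ : 𝓞 F),
          σ₀ ((g₂ : F) ^ 3) = formJ (principalForm (NumberField.discr K)) ∧
          (g₃ : F) ^ 2 = (g₂ : F) ^ 3 - 1728 ∧
          |(NumberField.discr F : ℝ)| ≤ (B * √|(NumberField.discr K : ℝ)|) ^ Module.finrank ℚ F) :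
    granville_stark := by
  intro habc δ hδ
  have hπ := Real.pi_pos
  -- the trivial case `δ ≥ π/3`
  rcases le_or_gt (π / 3) δ with hδπ | hδπ
  · refine ⟨3, fun K _ _ _ _ hd ↦ ?_⟩
    have hlog : 0 ≤ Real.log |(NumberField.discr K : ℝ)| := Real.log_nonneg (by linarith)
    have : (π / 3 - δ) * √|(NumberField.discr K : ℝ)| / Real.log |(NumberField.discr K : ℝ)| ≤ 0 :=
      div_nonpos_of_nonpos_of_nonneg
        (mul_nonpos_of_nonpos_of_nonneg (by linarith) (Real.sqrt_nonneg _)) hlog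
    exact this.trans (Nat.cast_nonneg _)
  -- constants
  set ε : ℝ := δ / (4 * π) with hεdef
  have hε0 : 0 < ε := by positivity
  have hε1 : ε < 1 / 12 := by rw [hεdef, div_lt_iff₀ (by positivity)]; linarith
  obtain ⟨C, hC⟩ := habc ε hε0
  obtain ⟨B, d₁, hL1⟩ := lemma1
  set C₁ : ℝ := max |C| 1 with hC₁def
  set B₁ : ℝ := max |B| 1 with hB₁def
  have hC₁ : 1 ≤ C₁ := le_max_right _ _
  have hB₁ : 1 ≤ B₁ := le_max_right _ _
  have hl1728 : (0 : ℝ) ≤ Real.log 1728 := Real.log_nonneg (by norm_num)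
  have hl1729 : (0 : ℝ) ≤ Real.log 1729 := Real.log_nonneg (by norm_num)
  have hl6 : (0 : ℝ) ≤ Real.log 6 := Real.log_nonneg (by norm_num)
  have hlC₁ : 0 ≤ Real.log C₁ := Real.log_nonneg hC₁
  have hlB₁ : 0 ≤ Real.log B₁ := Real.log_nonneg hB₁
  set LA : ℝ := Real.log 1728 + Real.log C₁ +
    (1 + ε) * (Real.log B₁ + Real.log 6 + Real.log 1729 / 2) with hLAdef
  have hLA : 0 ≤ LA := by positivity
  obtain ⟨d₂, hd₂0, hend⟩ := endgame hδ hδπ hLA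
  refine ⟨max (max d₁ d₂) 100, fun K _ _ h2 h0 hd ↦ ?_⟩
  -- the field `K`
  set D : ℤ := NumberField.discr K with hDdef
  have hd₁ : d₁ ≤ |(D : ℝ)| := le_trans (le_max_left _ _) (le_trans (le_max_left _ _) hd)
  have hd₂ : d₂ ≤ |(D : ℝ)| := le_trans (le_max_right _ _) (le_trans (le_max_left _ _) hd)
  have hd100 : 100 ≤ |(D : ℝ)| := le_trans (le_max_right _ _) hd
  have hK : IsImaginaryQuadratic K := ⟨h2, NumberField.nrRealPlaces_eq_zero_iff.mp h0⟩
  have hDneg : D < 0 := hK.discr_neg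
  have hdD : |(D : ℝ)| = -(D : ℝ) := abs_of_neg (by exact_mod_cast hDneg)
  set d : ℝ := |(D : ℝ)| with hddef
  have hd0 : 0 < d := by linarith
  have h4 : D % 4 = 0 ∨ D % 4 = 1 := by
    obtain ⟨b, hb⟩ := exists_basis_zero_eq_one (K := K) h2
    have hDtm := discr_eq_sq_add_four_mul b hb
    rw [← hDdef] at hDtm
    rcases Int.even_or_odd (b.repr (b 1 * b 1) 1) with ⟨r, hr⟩ | ⟨r, hr⟩
    · left; rw [hDtm, hr]; ring_nf; omega
    · right; rw [hDtm, hr]; ring_nf; omega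
  -- the CM data from Lemma 1
  obtain ⟨F, _, _, σ₀, g₂, g₃, hj, hγ, hDF⟩ := hL1 K h2 h0 hd₁
  set j₀ : ℂ := formJ (principalForm D) with hj₀def
  set jF : F := (g₂ : F) ^ 3 with hjFdef
  set n : ℕ := Module.finrank ℚ F with hndef
  have hn0 : 0 < n := Module.finrank_pos
  -- `|j(τ)| ≥ e^{π√d - 1}`
  have hπd : 10 ≤ π * √d := by
    have h10 : (10 : ℝ) ≤ √d := by
      rw [show (10 : ℝ) = √100 by rw [show (100 : ℝ) = 10 ^ 2 by norm_num, Real.sqrt_sq (by norm_num)]]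
      exact Real.sqrt_le_sqrt hd100
    have h3 : (3 : ℝ) ≤ π := by linarith [Real.pi_gt_three]
    nlinarith
  have hexp_small : Real.exp (-(π * √(-(D : ℝ)))) ≤ 1 / 10 ^ 4 := by
    rw [← hdD, Real.exp_neg]
    rw [inv_le_comm₀ (Real.exp_pos _) (by norm_num), one_div, inv_inv]
    exact ten_pow_four_le_exp_ten.trans (Real.exp_le_exp.2 hπd)
  have hj₀ : Real.exp (π * √d) - 784 ≤ ‖j₀‖ := by
    have := exp_sub_le_norm_formJ_principalForm_of_exp_le hDneg h4 hexp_small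
    rwa [← hdD] at this
  have hj₀' : Real.exp (π * √d - 1) ≤ ‖j₀‖ := by
    refine le_trans ?_ hj₀
    rw [Real.exp_sub]
    have hE : (10 : ℝ) ^ 4 ≤ Real.exp (π * √d) := ten_pow_four_le_exp_ten.trans (Real.exp_le_exp.2 hπd)
    have h1 : Real.exp (π * √d) / Real.exp 1 = Real.exp (π * √d) * Real.exp (-1) := by
      rw [Real.exp_neg, div_eq_mul_inv]
    rw [h1]
    nlinarith [exp_neg_one_le_half, Real.exp_pos (π * √d), Real.exp_pos (-1 : ℝ)]
  have hj₀pos : 1728 < ‖j₀‖ := by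
    have hE : (10 : ℝ) ^ 4 ≤ Real.exp (π * √d) := ten_pow_four_le_exp_ten.trans (Real.exp_le_exp.2 hπd)
    linarith
  -- non-vanishing
  have hσjF : σ₀ jF = j₀ := hj
  have hjF0 : jF ≠ 0 := by
    intro h; rw [h, map_zero] at hσjF
    rw [← hσjF, norm_zero] at hj₀pos; linarith
  have hg₂0 : g₂ ≠ 0 := by
    rintro rfl; apply hjF0; rw [hjFdef]; simp
  have hg₂F0 : (g₂ : F) ≠ 0 := fun h ↦ hg₂0 (by exact_mod_cast h)
  have hjF1728 : jF - 1728 ≠ 0 := by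
    intro h
    have : σ₀ jF = 1728 := by rw [sub_eq_zero.1 h, map_ofNat]
    rw [hσjF] at this
    rw [this] at hj₀pos; norm_num at hj₀pos
  have hg₃F0 : (g₃ : F) ≠ 0 := by
    intro h; apply hjF1728; rw [← hγ, h]; ring
  have hg₃0 : g₃ ≠ 0 := fun h ↦ hg₃F0 (by rw [h]; rfl)
  -- uniform abc in `F` applied to `γ₃² + 1728 = γ₂³`
  have habc' := hC F ((g₃ : F) ^ 2) 1728 jF (pow_ne_zero 2 hg₃F0) (by norm_num) hjF0
    (by rw [hγ]; ring)
  -- the archimedean size `M` of `j`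
  set M : ℝ := ∏ w : InfinitePlace F, (max 1 (w jF)) ^ w.mult with hMdef
  have hM1 : 1 ≤ M := one_le_prod_infinitePlace jF
  have hM0 : 0 < M := by linarith
  set H : ℝ := mulHeight ![(g₃ : F) ^ 2, (1728 : F), jF] with hHdef
  have hH0 : 0 < H := mulHeight_pos _
  have hMH : M ≤ (1728 : ℝ) ^ n * H := by
    have := prod_infinitePlace_le_mul_mulHeight (g₃ ^ 2) (g₂ ^ 3) (m := 1728) (by norm_num)
    push_cast at this
    exact this
  -- the radical
  set Nr : ℝ := (radicalNorm ((g₃ : F) ^ 2) (1728 : F) jF : ℝ) with hNrdef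
  have hNr1 : 1 ≤ Nr := by
    rw [hNrdef]; exact_mod_cast one_le_radicalNorm_triple _ _ _
  set N₂ : ℝ := |(Algebra.norm ℚ (g₂ : F) : ℝ)| with hN₂def
  set N₃ : ℝ := |(Algebra.norm ℚ (g₃ : F) : ℝ)| with hN₃def
  have hN₂0 : 0 < N₂ := by
    rw [hN₂def, abs_pos]; exact_mod_cast Algebra.norm_ne_zero_iff.2 hg₂F0
  have hN₃0 : 0 < N₃ := by
    rw [hN₃def, abs_pos]; exact_mod_cast Algebra.norm_ne_zero_iff.2 hg₃F0
  have hNr : Nr ≤ (6 : ℝ) ^ n * N₂ * N₃ := by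
    have h1 := radicalNorm_le_natAbs_norm g₂ g₃ hg₂0 hg₃0
    have h2 : Nr ≤ ((Algebra.norm ℤ (6 * g₂ * g₃ : 𝓞 F)).natAbs : ℝ) := by
      rw [hNrdef]; exact_mod_cast h1
    rw [natAbs_norm_six_mul] at h2
    exact h2
  -- norms against `M`
  have hN₂M : N₂ ^ 3 ≤ M := by
    have := abs_norm_le_prod_infinitePlace jF
    rwa [hjFdef, map_pow, Rat.cast_pow, abs_pow] at this
  have hN₃M : N₃ ^ 2 ≤ (1729 : ℝ) ^ n * M := by
    have h1 := abs_norm_sub_le_prod_infinitePlace jF 1728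
    simp only [Nat.cast_ofNat] at h1
    rw [← hγ, map_pow, Rat.cast_pow, abs_pow] at h1
    refine h1.trans (le_of_eq ?_)
    norm_num [hndef, hMdef]
  -- the discriminant of `F`
  have hDF1 : 1 ≤ |(NumberField.discr F : ℝ)| := by
    have := NumberField.discr_ne_zero F
    have h1 : (1 : ℤ) ≤ |NumberField.discr F| := Int.one_le_abs this
    exact_mod_cast h1
  have hDF' : |(NumberField.discr F : ℝ)| ≤ (B₁ * √d) ^ n := by
    refine hDF.trans ?_
    calc (B * √d) ^ n ≤ |(B * √d) ^ n| := le_abs_self _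
      _ = (|B| * √d) ^ n := by rw [abs_pow, abs_mul, abs_of_nonneg (Real.sqrt_nonneg _)]
      _ ≤ (B₁ * √d) ^ n := by
          apply pow_le_pow_left₀ (by positivity)
          exact mul_le_mul_of_nonneg_right (le_max_left _ _) (Real.sqrt_nonneg _)
  -- the degree of `j` and the class numbers
  obtain ⟨e, he, heM⟩ := exists_pow_le_prod_infinitePlace jF σ₀
  rw [← hMdef] at heM
  have hdeg : (minpoly ℚ jF).natDegree = classNumber D := by
    have h1 : minpoly ℚ (σ₀.toRatAlgHom jF) = minpoly ℚ jF :=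
      minpoly.algHom_eq σ₀.toRatAlgHom σ₀.injective jF
    have h2 : σ₀.toRatAlgHom jF = j₀ := hσjF
    rw [← h1, h2]
    exact natDegree_minpoly_formJ_principalForm hDneg h4
  rw [hdeg] at he
  have hhK : classNumber D ≤ NumberField.classNumber K := classNumber_discr_le_classNumber K hK
  have hh0 : 0 < classNumber D := classNumber_pos hDneg h4
  have he0 : 0 < e := by
    rcases Nat.eq_zero_or_pos e with h | h
    · rw [h, zero_mul] at he; omega
    · exact h
  -- from here on `M, H, Nr, N₂, N₃` are just positive reals
  have hNr0 : 0 < Nr := by linarith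
  have hDF0 : 0 < |(NumberField.discr F : ℝ)| := by linarith
  clear_value M H Nr N₂ N₃
  -- logarithms
  have hlow : (e : ℝ) * (π * √d - 1) ≤ Real.log M := by
    have h1 : Real.exp (π * √d - 1) ≤ max 1 ‖σ₀ jF‖ := by
      rw [hσjF]; exact hj₀'.trans (le_max_right _ _)
    have h2 : π * √d - 1 ≤ Real.log (max 1 ‖σ₀ jF‖) := by
      rw [← Real.log_exp (π * √d - 1)]
      exact Real.log_le_log (Real.exp_pos _) h1
    have h3 : (e : ℝ) * Real.log (max 1 ‖σ₀ jF‖) ≤ Real.log M := by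
      rw [← Real.log_pow]; exact Real.log_le_log (by positivity) heM
    exact (mul_le_mul_of_nonneg_left h2 (Nat.cast_nonneg e)).trans h3
  have ha : Real.log M ≤ n * Real.log 1728 + Real.log H := by
    rw [← Real.log_pow, ← Real.log_mul (by positivity) hH0.ne']
    exact Real.log_le_log hM0 hMH
  have hb : Real.log H < n * Real.log C₁ +
      (1 + ε) * (Real.log |(NumberField.discr F : ℝ)| + Real.log Nr) := by
    have hX0 : 0 < |(NumberField.discr F : ℝ)| * Nr := mul_pos hDF0 hNr0
    have hC₁n : 0 < C₁ ^ n := pow_pos (by linarith) n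
    have hXε : 0 < (|(NumberField.discr F : ℝ)| * Nr) ^ (1 + ε) := Real.rpow_pos_of_pos hX0 _
    have h1 : H < C₁ ^ n * (|(NumberField.discr F : ℝ)| * Nr) ^ (1 + ε) := by
      refine habc'.trans_le ?_
      refine mul_le_mul_of_nonneg_right ?_ hXε.le
      calc C ^ n ≤ |C ^ n| := le_abs_self _
        _ = |C| ^ n := abs_pow _ _
        _ ≤ C₁ ^ n := pow_le_pow_left₀ (abs_nonneg _) (le_max_left _ _) _
    have h2 := Real.log_lt_log hH0 h1
    rwa [Real.log_mul hC₁n.ne' hXε.ne', Real.log_pow, Real.log_rpow hX0,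
      Real.log_mul hDF0.ne' hNr0.ne'] at h2
  have hc : Real.log Nr ≤ n * Real.log 6 + Real.log N₂ + Real.log N₃ := by
    have h6 : (0 : ℝ) < 6 ^ n := by positivity
    rw [← Real.log_pow, ← Real.log_mul h6.ne' hN₂0.ne',
      ← Real.log_mul (mul_pos h6 hN₂0).ne' hN₃0.ne']
    exact Real.log_le_log hNr0 hNr
  have hd2 : 3 * Real.log N₂ ≤ Real.log M := by
    have : Real.log (N₂ ^ 3) ≤ Real.log M := Real.log_le_log (pow_pos hN₂0 3) hN₂M
    rwa [Real.log_pow, Nat.cast_ofNat] at this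
  have hd3 : 2 * Real.log N₃ ≤ n * Real.log 1729 + Real.log M := by
    have h9 : (0 : ℝ) < 1729 ^ n := by positivity
    have : Real.log (N₃ ^ 2) ≤ Real.log ((1729 : ℝ) ^ n * M) :=
      Real.log_le_log (pow_pos hN₃0 2) hN₃M
    rwa [Real.log_pow, Nat.cast_ofNat, Real.log_mul h9.ne' hM0.ne', Real.log_pow] at this
  have hDFlog : Real.log |(NumberField.discr F : ℝ)| ≤ n * (Real.log B₁ + Real.log d / 2) := by
    have h1 := Real.log_le_log hDF0 hDF'
    rw [Real.log_pow, Real.log_mul (by positivity) (Real.sqrt_pos.2 hd0).ne',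
      Real.log_sqrt hd0.le] at h1
    exact h1
  have hn' : (n : ℝ) = (e : ℝ) * (classNumber D : ℝ) := by
    rw [hndef, ← he]; push_cast; ring
  have hmain := loglinear (X := π * √d - 1) (by linarith) (by linarith)
    hn' (by exact_mod_cast he0) ha hb hc hd2 hd3 hDFlog hlow
  -- the endgame
  have hfin := hend d hd₂ (classNumber D) (Nat.cast_nonneg _) hmain
  exact hfin.trans (by exact_mod_cast hhK)

end Literature.NumberTheory.DiophantineGeometry

end
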